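import Mathlib
import Summits.CriticalPhenomena.CardyFormulaZ2.Theorems.CardyMagicRigidityDefs
import Summits.CriticalPhenomena.CardyFormulaZ2.Theorems.CardyMagicRigidityNestingRigidityTowerPressureSanity
import HarnessLib

/-!
# Crux `NestingRigidity`, line `ring-cloud-tomography`, stub S3 `ChargeQuantisation`: reductions

Stub S3 of the checked skeleton (`stmt-CriticalPhenomena-4835`) asks, for each lattice ensemble
`E ∈ {zEns, tEns}` with the cloud law, that a tower-pressure law inside the one-parameter family
`pressureFamily a` on `[0, √3]` forces the pressure to be Schramm–Sheffield–Wilson's `e₆`.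

This file records the elementary, model-free part of S3 (everything that does NOT need the open
analytic input "quantisation of the background charge"):

* `pressureFamily_zero`: `e_a(0) = 1/48 + aπ/6`, so `e_a(0) = 5/48 ↔ a = 1/(2π)`
  (note `e_a(u) − e₆(u) = (a − 1/2π)(arccos(u/2) − π/3)`: any single `u ≠ 1` would pin `a`)
  (`e₆ = e_{1/2π}`, `e₆(0) = 5/48`, `e_a(1) = 0` are in the sibling module `…TowerPressureSanity`);
* `LoopEnsemble.HasTowerPressure.eqOn`: tower exponents in sandwich form are UNIQUE on the weight
  set (pure filter argument, no measurability needed), and `towerExponent_one`: `e(1) = 0`;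
* `chargeQuantisation_iff`: `ChargeQuantisation` is EQUIVALENT to "family law with parameter `a` ⇒
  `a = 1/(2π)`"; `chargeQuantisation_of_towerExponent_zero` (registered sub-goal): it follows from
  the single number "the `u = 0` tower exponent (a one-arm exponent) is `5/48`";
  `towerExponent_one_eq_pressureFamily_one` (registered sub-goal): the soft constraint `e(1) = 0`
  holds for `zEns`, `tEns` and is met by every `pressureFamily a`.

The soft structure of `u ↦ E_δ[u^N]` (monotone, `= 1` at `u = 1`, log-convex in `log u`) only
confines `a` to `[1/(4π) + 3√3/(8π²), ∞) ∋ 1/(2π)` (see the line notes), so S3 proper needs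
model-specific input; nothing here asserts it.
-/

noncomputable section

open MeasureTheory Set Filter Metric
open scoped Real Topology BigOperators

namespace Summit.CriticalPhenomena.CardyFormulaZ2.Cruxes.NestingRigidity.RingCloudTomography

open Literature.Probability.RandomPlanarGeometry Literature.Probability.Percolation
  Literature.Probability.LatticeModels

/-! ## The one-parameter family versus `e₆` -/

/-- Value of the family at `u = 0`: `e_a(0) = 1/48 + aπ/6` (`arccos 0 = π/2`). -/
theorem pressureFamily_zero (a : ℝ) : pressureFamily a 0 = 1 / 48 + a * (π / 6) := by
  unfold pressureFamily
  rw [zero_div, Real.arccos_zero]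
  have hπ : (π : ℝ) ≠ 0 := Real.pi_ne_zero
  field_simp
  ring

/-- `e_a(0) = 5/48 ↔ a = 1/(2π)`: the `u = 0` exponent alone pins the background charge. -/
theorem pressureFamily_zero_eq_iff (a : ℝ) : pressureFamily a 0 = 5 / 48 ↔ a = 1 / (2 * π) := by
  rw [pressureFamily_zero]
  have hπ : (π : ℝ) ≠ 0 := Real.pi_ne_zero
  constructor
  · intro h
    rw [eq_div_iff (by positivity)]
    linear_combination 12 * h
  · rintro rfl
    field_simp
    ring

/-! ## Model-free facts about sandwich-form tower pressures -/

namespace LoopEnsemble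

/-- Restricting the weight set preserves a tower-pressure law. -/
theorem HasTowerPressure.mono {E : LoopEnsemble} {e : ℝ → ℝ} {S T : Set ℝ}
    (h : E.HasTowerPressure e S) (hTS : T ⊆ S) : E.HasTowerPressure e T :=
  fun u hu ↦ h u (hTS hu)

/-- **Uniqueness of tower exponents.** Two exponent functions in sandwich form for the same
ensemble agree on the common weight set: for `0 < ρ < 1` the two sandwiches at a common `(ρ, δ)`
give `ρ^{e(u)+ε} ≤ ρ^{e'(u)−ε}` and symmetrically, i.e. `|e(u) − e'(u)| ≤ 2ε` for every `ε > 0`.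
No measurability or positivity of the moments is needed. -/
theorem HasTowerPressure.eqOn {E : LoopEnsemble} {e e' : ℝ → ℝ} {S : Set ℝ}
    (h : E.HasTowerPressure e S) (h' : E.HasTowerPressure e' S) : EqOn e e' S := by
  intro u hu
  by_contra hne
  have hd : 0 < |e u - e' u| := abs_pos.mpr (sub_ne_zero.mpr hne)
  set d := |e u - e' u| with hd_def
  have hρ : ∀ᶠ ρ in 𝓝[>] (0 : ℝ), ρ < 1 := nhdsWithin_le_nhds (Iio_mem_nhds zero_lt_one)
  obtain ⟨ρ, ⟨⟨hρ0, hρ1⟩, hA⟩, hB⟩ :=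
    (((eventually_mem_nhdsWithin.and hρ).and (h u hu (d / 4) (by linarith))).and
      (h' u hu (d / 4) (by linarith))).exists
  have hρ0' : 0 < ρ := hρ0
  obtain ⟨δ, ⟨hA1, hA2⟩, hB1, hB2⟩ := (hA.and hB).exists
  have h1 : e' u - d / 4 ≤ e u + d / 4 :=
    (Real.rpow_le_rpow_left_iff_of_base_lt_one hρ0' hρ1).mp (hA1.trans hB2)
  have h2 : e u - d / 4 ≤ e' u + d / 4 :=
    (Real.rpow_le_rpow_left_iff_of_base_lt_one hρ0' hρ1).mp (hB1.trans hA2)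
  have h3 : |e u - e' u| ≤ d / 2 := abs_sub_le_iff.mpr ⟨by linarith, by linarith⟩
  rw [← hd_def] at h3
  linarith

/-- Any tower-pressure law of a probability ensemble on a weight set containing `1` has
`e(1) = 0` (the soft normalisation constraint; satisfied by every `pressureFamily a` and by `e₆`). -/
theorem towerExponent_one (E : LoopEnsemble) [IsProbabilityMeasure E.P] {e : ℝ → ℝ} {S : Set ℝ}
    (h : E.HasTowerPressure e S) (h1 : (1 : ℝ) ∈ S) : e 1 = 0 := by
  have h0 : E.HasTowerPressure (fun _ ↦ (0 : ℝ)) {1} := by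
    intro u hu ε hε
    rw [Set.mem_singleton_iff] at hu
    subst hu
    have hρ : ∀ᶠ ρ in 𝓝[>] (0 : ℝ), ρ < 1 := nhdsWithin_le_nhds (Iio_mem_nhds zero_lt_one)
    filter_upwards [eventually_mem_nhdsWithin, hρ] with ρ hρ0 hρ1
    have hρ0' : 0 < ρ := hρ0
    refine Eventually.of_forall fun δ ↦ ?_
    rw [towerMoment_one, zero_add, zero_sub]
    exact ⟨Real.rpow_le_one hρ0'.le hρ1.le hε.le,
      Real.one_le_rpow_of_pos_of_le_one_of_nonpos hρ0' hρ1.le (by linarith)⟩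
  exact (h.mono (Set.singleton_subset_iff.mpr h1)).eqOn h0 rfl

end LoopEnsemble

/-- **Registered sub-goal (soft constraint (E0)).** For both lattice ensembles, any sandwich-form
tower pressure on a weight set containing `1` has `e(1) = 0 = e_a(1)` for EVERY `a`: the
normalisation `E_δ[1^N] = 1` is satisfied by the whole family and does not constrain the charge. -/
theorem towerExponent_one_eq_pressureFamily_one :
    ∀ E ∈ latticeEnsembles, ∀ (e : ℝ → ℝ) (S : Set ℝ), E.HasTowerPressure e S → (1 : ℝ) ∈ S →
      ∀ a : ℝ, e 1 = pressureFamily a 1 := by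
  intro E hE e S h h1 a
  haveI := isProbabilityMeasure_of_mem hE
  rw [pressureFamily_one]
  exact E.towerExponent_one h h1

/-! ## S3 reduced to one number -/

/-- `ChargeQuantisation` (stub S3) is equivalent to the quantisation of
the background charge: for each lattice ensemble with the cloud law, a tower-pressure law in the
family `pressureFamily a` on `[0, √3]` forces `a = 1/(2π)`. (`→`: uniqueness of exponents at
`u = 0`; `←`: `e₆ = e_{1/(2π)}`.) -/
theorem chargeQuantisation_iff :
    ChargeQuantisation ↔ ∀ E ∈ latticeEnsembles, E.CloudLaw → ∀ a : ℝ,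
      E.HasTowerPressure (pressureFamily a) (Icc 0 (Real.sqrt 3)) → a = 1 / (2 * π) := by
  constructor
  · intro h E hE hC a ha
    have h6 := h E hE hC ⟨a, ha⟩
    have h0 : pressureFamily a 0 = e6 0 := ha.eqOn h6 ⟨le_rfl, Real.sqrt_nonneg 3⟩
    rw [e6_zero, pressureFamily_zero_eq_iff] at h0
    exact h0
  · rintro h E hE hC ⟨a, ha⟩
    obtain rfl : a = 1 / (2 * π) := h E hE hC a ha
    rwa [← e6_eq_pressureFamily] at ha

/-- **Registered sub-goal.** `ChargeQuantisation` follows from the identification of the `u = 0` tower exponent of each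
lattice ensemble (under the cloud law, inside any sandwich law on `[0, √3]`) with the one-arm
exponent `5/48` — for `tEns` this is Lawler–Schramm–Werner's exponent
(`Literature.Probability.Percolation.oneArm_exponent`) plus a loop/arm dictionary; for `zEns` it
is open. -/
theorem chargeQuantisation_of_towerExponent_zero :
    (∀ E ∈ latticeEnsembles, E.CloudLaw → ∀ e : ℝ → ℝ,
      E.HasTowerPressure e (Icc 0 (Real.sqrt 3)) → e 0 = 5 / 48) → ChargeQuantisation := by
  rw [chargeQuantisation_iff]
  intro h E hE hC a ha
  exact (pressureFamily_zero_eq_iff a).mp (h E hE hC _ ha)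

end Summit.CriticalPhenomena.CardyFormulaZ2.Cruxes.NestingRigidity.RingCloudTomography

end
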